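import Summits.HodgeConjecture.HodgeConjecture.Theorems.K2LiuDoublingUnfoldTwist
import Summits.HodgeConjecture.HodgeConjecture.Theorems.K2LiuDoubledThetaPairingContinuous
import Literature.NumberTheory.Automorphic.AdelicGroupDataCompactMeasure
import Literature.NumberTheory.Automorphic.AdelicHeightGLContinuity
import Literature.NumberTheory.Automorphic.AdelicHeightGLProofs
import HarnessLib

/-!
# The Eisenstein kernel of the doubling pairing read on `[G]²`: continuity, representatives, a uniform bound from moderate growth; the frame
# transport `ιA`; the twist — organs (g1)(g2)(g3) of the s5 payer #47 `K2LiuFirstTermThetaPairing` (`K2/K2Liu-p03/g3`)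

Track B ∕ hLiu418 = stmt-HodgeConjecture-24832, line `K2_Liu_CurveThetaSigs` ∕ tier-0 `K2_Liu_CurveThetaNonOrthogonal` (stub s5 `stub_firstTermThetaPairing`),
assembly #47 (LEAD F0P6-plan 2026-09-04 03:25Z (1)); seat `hodgecm-mathlib-K2Liu-p03` (g3).  Glue between socket #41's output (a continuous, left
`H(L⁺)`-invariant function `E⋆(s,·)` on `H(𝔸)` of moderate growth `|E⋆(s,h)| ≤ C ‖h‖^A`) and the hypotheses of the ★ analytic sockets #43a ∕ #43 (measurable,
uniformly bounded kernels on `[G]²`):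

* §1 (not restated) s5's frame transport `ιA` (pinned by `(ιA k) = ĝ⁻¹ k ĝ`) is continuous and carries `G(L⁺)` into `U(d_V)(L⁺)`: ★
  `F0LD2FrameTransportPin.continuous_of_pin` ∕ `mem_range_toAdelic_of_pin` — the `hιAc ∕ hιAr` binders of ★ #44∕45R ∕ #45D and of §2 below;
* §2 for `E : H(𝔸) → ℂ` left `H(L⁺)`-invariant: `toQuotFun₂_eisenstein_mk` (the kernel `toQuotFun₂ (g ↦ E(ι(ιA g₁, ιA g₂)))` at `(g₁Γ, g₂Γ)` is
  `E(ι(ιA g₁⁻¹, ιA g₂⁻¹))`), `continuous_toQuotFun₂_eisenstein` (continuous when `E` is), **`exists_bound_toQuotFun₂_eisenstein`** — for every exponent `A` there is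
  `M ≥ 0` with `‖kernel x‖ ≤ C · M` for ALL `x ∈ [G]²` whenever `|E(h)| ≤ C ‖h‖^A` on `H(𝔸)` (compact set of representatives ★ `exists_isCompact_image_coe_eq_univ`,
  ★ `continuous_adelicHeightGL`, ★ `adelicHeightGL_pos_holds`) — uniform in `E`, hence in `s`;
* §3 `twist_eq_twist` — the doubling twist `conj χ_s(ι(a_x, a_x))` does not depend on `s` (★ `siegelDeltaCharacter_iotaV_diag`: `|det_Δ ι(a,a)| = 1`);
  `memLp_two_twist_mul` — `T̄ · w′ ∈ L²(μ)` for `w′ ∈ L²(μ)` (★ `continuous_twist`, `[G]` compact).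
[cite: Liu2021, Lem. B.11–B.12 pp. 102–104] [cite: MoeglinWaldspurger1995, I.2.2, IV.1.9] [cite: HarrisKudlaSweet1996, §1 (1.11)–(1.15)]

No definition, no instance, no named fact, no `sorry`; axioms ⊆ {propext, Classical.choice, Quot.sound}.

## References
* [Liu2021] Y. Liu, Camb. J. Math. 9 (2021), App. B Lem. B.11–B.12 pp. 102–104.
* [MoeglinWaldspurger1995] C. Moeglin, J.-L. Waldspurger, *Spectral Decomposition and Eisenstein Series*, CUP (1995), I.2.2, IV.1.9.
* [HarrisKudlaSweet1996] M. Harris, S. Kudla, W. J. Sweet, J. AMS 9 (1996), §1 (1.11)–(1.15).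
* [PlatonovRapinchuk1994] V. Platonov, A. Rapinchuk, *Algebraic Groups and Number Theory* (1994), §2.3, §5.1.

HONEST LABEL: HC_CM is proved only modulo the 7 printed citations (2 remaining named inputs: hLiu418 = stmt-HodgeConjecture-24832, h413 =
stmt-HodgeConjecture-24833) until rung 0 closes; this helper moves no counter.
-/

set_option autoImplicit false

set_option linter.dupNamespace false

noncomputable section

open scoped Matrix Topology ComplexConjugate ENNReal
open NumberField IsDedekindDomain MeasureTheory Filter Set

namespace Summit.HodgeConjecture.HodgeConjecture.Cruxes.HLiu418.K2LiuEisensteinPairingKernel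

open Literature.NumberTheory.Automorphic Literature.NumberTheory.GaloisRepresentations
open Literature.NumberTheory.Automorphic.UnitaryGroup
open Literature.NumberTheory.Automorphic.UnitaryGroup.CotangentForms (toQuotFun)
open Literature.NumberTheory.GelbartRogawski1991 Literature.NumberTheory.GelbartRogawski1991.GRConstruction
open Literature.NumberTheory.K2Lit.SiegelDoubled
open Summit.HodgeConjecture.HodgeConjecture.Cruxes.HLiu418.K2LiuDoublingUnfoldBridge
open Summit.HodgeConjecture.HodgeConjecture.Cruxes.HLiu418.K2LiuDoublingUnfoldTwist
open Summit.HodgeConjecture.HodgeConjecture.Cruxes.HLiu418.K2LiuThetaKernelSliceIntegral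
open Summit.HodgeConjecture.HodgeConjecture.Cruxes.HLiu418.K2LiuDoubledThetaPairingContinuous

variable (L : Type) [Field L] [NumberField L] [IsCMField L]
variable {N n : ℕ} (e : Fin N × Fin 1 ≃ Fin n) (H : Matrix (Fin N) (Fin N) L)
  (dV : Fin N → L) (hdV : ∀ i, IsCMField.complexConj L (dV i) = dV i) (hdV0 : ∀ i, dV i ≠ 0)
  (dW : Fin 1 → L) (hdW : ∀ i, IsCMField.complexConj L (dW i) = dW i) (hdW0 : ∀ i, dW i ≠ 0)
  (t : L) (ht : t ≠ 0) (g : GL (Fin N) L)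
  (hg : formCongr ((IsCMField.complexConj L : L ≃ₐ[↥(maximalRealSubfield L)] L) : L →+* L) g (t • H) = Matrix.diagonal dV)
  (ιA : (adelicGroupData (↥(maximalRealSubfield L)) L (IsCMField.complexConj L) N H).Adelic →*
    ↥(UnitaryGroup.adelic (↥(maximalRealSubfield L)) L (IsCMField.complexConj L) N (Matrix.diagonal dV)))
  (hιA : ∀ k, ((ιA k : ↥(UnitaryGroup.adelic (↥(maximalRealSubfield L)) L (IsCMField.complexConj L) N (Matrix.diagonal dV))) :
        GL (Fin N) (AdeleRing (𝓞 L) L)) =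
      (toAdeleGL L g)⁻¹ * adelicVal (↥(maximalRealSubfield L)) L (IsCMField.complexConj L) N H k * toAdeleGL L g)

/-! ## §1 The frame transport `ιA`: see ★ `F0LD2FrameTransportPin.continuous_of_pin` ∕ `mem_range_toAdelic_of_pin` (not restated) -/

/-! ## §2 The Eisenstein kernel on `[G]²` -/

section Kernel

variable (hιAr : ∀ ⦃γ : (adelicGroupData (↥(maximalRealSubfield L)) L (IsCMField.complexConj L) N H).Adelic⦄,
    γ ∈ (UnitaryGroup.toAdelic (↥(maximalRealSubfield L)) L (IsCMField.complexConj L) N H).range →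
      ιA γ ∈ (UnitaryGroup.toAdelic (↥(maximalRealSubfield L)) L (IsCMField.complexConj L) N (Matrix.diagonal dV)).range)

include hιAr in
/-- **The kernel at a pair of classes**: for `E` left `H(L⁺)`-invariant, `toQuotFun₂ (g ↦ E(ι(ιA g₁, ιA g₂))) (g₁Γ, g₂Γ) = E(ι(ιA g₁⁻¹, ιA g₂⁻¹))`
(★ `toQuotFun₂_mk`; invariance along `ι(ιA γ, 1), ι(1, ιA γ) ∈ H(L⁺)`, ★ `iotaV_iotaA_mem_ratH`). [cite: Liu2021, §B.3 (B.7) p. 101] -/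
theorem toQuotFun₂_eisenstein_mk (E : HA L e dV hdV dW hdW → ℂ)
    (hE : ∀ (γ : ratH L e dV hdV dW hdW) (h : HA L e dV hdV dW hdW), E ((γ : HA L e dV hdV dW hdW) * h) = E h)
    (g₁ g₂ : (adelicGroupData (↥(maximalRealSubfield L)) L (IsCMField.complexConj L) N H).Adelic) :
    toQuotFun₂ (adelicGroupData (↥(maximalRealSubfield L)) L (IsCMField.complexConj L) N H)
        (fun g => E (iotaV L e dV hdV dW hdW (ιA g.1, ιA g.2)))
        ((adelicGroupData (↥(maximalRealSubfield L)) L (IsCMField.complexConj L) N H).toAutomorphicQuotient g₁,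
          (adelicGroupData (↥(maximalRealSubfield L)) L (IsCMField.complexConj L) N H).toAutomorphicQuotient g₂) =
      E (iotaV L e dV hdV dW hdW (ιA g₁⁻¹, ιA g₂⁻¹)) := by
  have h₁ : ∀ γ ∈ (adelicGroupData (↥(maximalRealSubfield L)) L (IsCMField.complexConj L) N H).quotientSubgroup,
      ∀ k₁ k₂ : (adelicGroupData (↥(maximalRealSubfield L)) L (IsCMField.complexConj L) N H).Adelic,
        (fun g : (adelicGroupData (↥(maximalRealSubfield L)) L (IsCMField.complexConj L) N H).Adelic ×
            (adelicGroupData (↥(maximalRealSubfield L)) L (IsCMField.complexConj L) N H).Adelic =>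
          E (iotaV L e dV hdV dW hdW (ιA g.1, ιA g.2))) (γ * k₁, k₂) =
        (fun g : (adelicGroupData (↥(maximalRealSubfield L)) L (IsCMField.complexConj L) N H).Adelic ×
            (adelicGroupData (↥(maximalRealSubfield L)) L (IsCMField.complexConj L) N H).Adelic =>
          E (iotaV L e dV hdV dW hdW (ιA g.1, ιA g.2))) (k₁, k₂) := by
    intro γ hγ k₁ k₂
    have hmem := (iotaV_iotaA_mem_ratH L e H dV hdV dW hdW ιA hιAr hγ).1
    have hsplit : (ιA (γ * k₁), ιA k₂) =
        (ιA γ, (1 : ↥(UnitaryGroup.adelic (↥(maximalRealSubfield L)) L (IsCMField.complexConj L) N (Matrix.diagonal dV)))) * (ιA k₁, ιA k₂) := by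
      ext <;> simp
    show E (iotaV L e dV hdV dW hdW (ιA (γ * k₁), ιA k₂)) = E (iotaV L e dV hdV dW hdW (ιA k₁, ιA k₂))
    rw [hsplit, map_mul]
    exact hE ⟨_, hmem⟩ _
  have h₂ : ∀ γ ∈ (adelicGroupData (↥(maximalRealSubfield L)) L (IsCMField.complexConj L) N H).quotientSubgroup,
      ∀ k₁ k₂ : (adelicGroupData (↥(maximalRealSubfield L)) L (IsCMField.complexConj L) N H).Adelic,
        (fun g : (adelicGroupData (↥(maximalRealSubfield L)) L (IsCMField.complexConj L) N H).Adelic ×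
            (adelicGroupData (↥(maximalRealSubfield L)) L (IsCMField.complexConj L) N H).Adelic =>
          E (iotaV L e dV hdV dW hdW (ιA g.1, ιA g.2))) (k₁, γ * k₂) =
        (fun g : (adelicGroupData (↥(maximalRealSubfield L)) L (IsCMField.complexConj L) N H).Adelic ×
            (adelicGroupData (↥(maximalRealSubfield L)) L (IsCMField.complexConj L) N H).Adelic =>
          E (iotaV L e dV hdV dW hdW (ιA g.1, ιA g.2))) (k₁, k₂) := by
    intro γ hγ k₁ k₂
    have hmem := (iotaV_iotaA_mem_ratH L e H dV hdV dW hdW ιA hιAr hγ).2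
    have hsplit : (ιA k₁, ιA (γ * k₂)) =
        ((1 : ↥(UnitaryGroup.adelic (↥(maximalRealSubfield L)) L (IsCMField.complexConj L) N (Matrix.diagonal dV))), ιA γ) * (ιA k₁, ιA k₂) := by
      ext <;> simp
    show E (iotaV L e dV hdV dW hdW (ιA k₁, ιA (γ * k₂))) = E (iotaV L e dV hdV dW hdW (ιA k₁, ιA k₂))
    rw [hsplit, map_mul]
    exact hE ⟨_, hmem⟩ _
  rw [toQuotFun₂_mk h₁ h₂, map_inv, map_inv]

include hιAr in
/-- **The kernel of a CONTINUOUS left-invariant `E` is continuous on `[G]²`** when `ιA` is continuous (descent of the continuous right-`G(L⁺)²`-invariant map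
`(g₁,g₂) ↦ E(ι(ιA g₁⁻¹, ιA g₂⁻¹))`, ★ `continuous_out_of_invariant₂`). [cite: Liu2021, §B.3 (B.7) p. 101] [cite: MoeglinWaldspurger1995, IV.1.9] -/
theorem continuous_toQuotFun₂_eisenstein (hιAc : Continuous ιA) (E : HA L e dV hdV dW hdW → ℂ) (hEc : Continuous E)
    (hE : ∀ (γ : ratH L e dV hdV dW hdW) (h : HA L e dV hdV dW hdW), E ((γ : HA L e dV hdV dW hdW) * h) = E h) :
    Continuous (toQuotFun₂ (adelicGroupData (↥(maximalRealSubfield L)) L (IsCMField.complexConj L) N H)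
        (fun g => E (iotaV L e dV hdV dW hdW (ιA g.1, ιA g.2)))) := by
  refine continuous_out_of_invariant₂ (adelicGroupData (↥(maximalRealSubfield L)) L (IsCMField.complexConj L) N H)
    (fun g => E (iotaV L e dV hdV dW hdW (ιA g.1⁻¹, ιA g.2⁻¹))) ?_ ?_ ?_
  · exact hEc.comp ((continuous_iotaV L e dV hdV dW hdW).comp ((hιAc.comp continuous_fst.inv).prodMk (hιAc.comp continuous_snd.inv)))
  · intro γ hγ g₁ g₂
    have hmem := (iotaV_iotaA_mem_ratH L e H dV hdV dW hdW ιA hιAr (inv_mem hγ)).1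
    have hsplit : (ιA (g₁ * γ)⁻¹, ιA g₂⁻¹) =
        (ιA γ⁻¹, (1 : ↥(UnitaryGroup.adelic (↥(maximalRealSubfield L)) L (IsCMField.complexConj L) N (Matrix.diagonal dV)))) * (ιA g₁⁻¹, ιA g₂⁻¹) := by
      ext <;> simp [mul_inv_rev]
    show E (iotaV L e dV hdV dW hdW (ιA (g₁ * γ)⁻¹, ιA g₂⁻¹)) = E (iotaV L e dV hdV dW hdW (ιA g₁⁻¹, ιA g₂⁻¹))
    rw [hsplit, map_mul]
    exact hE ⟨_, hmem⟩ _
  · intro γ hγ g₁ g₂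
    have hmem := (iotaV_iotaA_mem_ratH L e H dV hdV dW hdW ιA hιAr (inv_mem hγ)).2
    have hsplit : (ιA g₁⁻¹, ιA (g₂ * γ)⁻¹) =
        ((1 : ↥(UnitaryGroup.adelic (↥(maximalRealSubfield L)) L (IsCMField.complexConj L) N (Matrix.diagonal dV))), ιA γ⁻¹) * (ιA g₁⁻¹, ιA g₂⁻¹) := by
      ext <;> simp [mul_inv_rev]
    show E (iotaV L e dV hdV dW hdW (ιA g₁⁻¹, ιA (g₂ * γ)⁻¹)) = E (iotaV L e dV hdV dW hdW (ιA g₁⁻¹, ιA g₂⁻¹))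
    rw [hsplit, map_mul]
    exact hE ⟨_, hmem⟩ _

include hιAr in
/-- **A UNIFORM BOUND ON `[G]²` FROM MODERATE GROWTH** (organ (g1) of #47): `[G]` compact, `ιA` continuous; for every exponent `A` there is `M ≥ 0` such that
for EVERY left `H(L⁺)`-invariant `E` with `|E(h)| ≤ C ‖h‖^A` on `H(𝔸)` (`‖h‖ =` ★ `adelicHeightGL`), the kernel satisfies `‖toQuotFun₂ (g ↦ E(ι(ιA g₁, ιA g₂))) x‖ ≤ C · M`
for all `x` — read each class on a COMPACT set of representatives (★ `exists_isCompact_image_coe_eq_univ`), where the continuous `‖ι(ιA b₁⁻¹, ιA b₂⁻¹)‖^A` is bounded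
(★ `continuous_adelicHeightGL`, ★ `adelicHeightGL_pos_holds`).  Uniform in `E`, hence in the parameter `s` of socket #41's family `E⋆(s, ·)`.
[cite: MoeglinWaldspurger1995, I.2.2, IV.1.9] [cite: Liu2021, Lem. B.12 pp. 103–104] -/
theorem exists_bound_toQuotFun₂_eisenstein [NeZero n] (hιAc : Continuous ιA)
    [CompactSpace (adelicGroupData (↥(maximalRealSubfield L)) L (IsCMField.complexConj L) N H).automorphicQuotient] (A : ℝ) :
    ∃ M : ℝ, 0 ≤ M ∧ ∀ (E : HA L e dV hdV dW hdW → ℂ),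
      (∀ (γ : ratH L e dV hdV dW hdW) (h : HA L e dV hdV dW hdW), E ((γ : HA L e dV hdV dW hdW) * h) = E h) →
      ∀ C : ℝ, (∀ h : HA L e dV hdV dW hdW, ‖E h‖ ≤ C * adelicHeightGL (n + n) L (h : GL (Fin (n + n)) (AdeleRing (𝓞 L) L)) ^ A) →
      ∀ x, ‖toQuotFun₂ (adelicGroupData (↥(maximalRealSubfield L)) L (IsCMField.complexConj L) N H)
          (fun g => E (iotaV L e dV hdV dW hdW (ιA g.1, ιA g.2))) x‖ ≤ C * M := by
  haveI : LocallyCompactSpace (adelicGroupData (↥(maximalRealSubfield L)) L (IsCMField.complexConj L) N H).Adelic :=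
    locallyCompactSpace_cmDatum_Adelic L N H
  haveI : CompactSpace ((adelicGroupData (↥(maximalRealSubfield L)) L (IsCMField.complexConj L) N H).Adelic ⧸
      (adelicGroupData (↥(maximalRealSubfield L)) L (IsCMField.complexConj L) N H).quotientSubgroup) :=
    inferInstanceAs (CompactSpace (adelicGroupData (↥(maximalRealSubfield L)) L (IsCMField.complexConj L) N H).automorphicQuotient)
  obtain ⟨B, hB, hBcov⟩ := exists_isCompact_image_coe_eq_univ
    (adelicGroupData (↥(maximalRealSubfield L)) L (IsCMField.complexConj L) N H).quotientSubgroup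
  -- the height of `ι(ιA b₁⁻¹, ιA b₂⁻¹)` to the power `A` is continuous, hence bounded on `B × B`
  set φ : (adelicGroupData (↥(maximalRealSubfield L)) L (IsCMField.complexConj L) N H).Adelic ×
      (adelicGroupData (↥(maximalRealSubfield L)) L (IsCMField.complexConj L) N H).Adelic → ℝ :=
    fun b => adelicHeightGL (n + n) L ((iotaV L e dV hdV dW hdW (ιA b.1⁻¹, ιA b.2⁻¹) : HA L e dV hdV dW hdW) :
      GL (Fin (n + n)) (AdeleRing (𝓞 L) L)) ^ A with hφ
  have hpos : ∀ h : HA L e dV hdV dW hdW, 0 < adelicHeightGL (n + n) L (h : GL (Fin (n + n)) (AdeleRing (𝓞 L) L)) :=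
    fun h => adelicHeightGL_pos_holds _
  have hφc : Continuous φ := by
    refine Continuous.rpow_const ?_ fun b => Or.inl (hpos _).ne'
    exact continuous_adelicHeightGL.comp (continuous_subtype_val.comp ((continuous_iotaV L e dV hdV dW hdW).comp
      ((hιAc.comp continuous_fst.inv).prodMk (hιAc.comp continuous_snd.inv))))
  obtain ⟨M₀, hM₀⟩ := (hB.prod hB).bddAbove_image hφc.continuousOn
  refine ⟨max M₀ 0, le_max_right _ _, fun E hE C hC x => ?_⟩
  -- `C ≥ 0` (the growth bound at `h = 1` with a positive power of the height)
  have hC0 : 0 ≤ C := by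
    have h1 := hC 1
    have hp : 0 < adelicHeightGL (n + n) L ((1 : HA L e dV hdV dW hdW) : GL (Fin (n + n)) (AdeleRing (𝓞 L) L)) ^ A :=
      Real.rpow_pos_of_pos (hpos 1) A
    nlinarith [norm_nonneg (E 1)]
  -- read `x` on representatives in `B × B`
  obtain ⟨b₁, hb₁, hx₁⟩ : x.1 ∈ (QuotientGroup.mk : _ → _ ⧸ _) '' B := by rw [hBcov]; exact mem_univ _
  obtain ⟨b₂, hb₂, hx₂⟩ : x.2 ∈ (QuotientGroup.mk : _ → _ ⧸ _) '' B := by rw [hBcov]; exact mem_univ _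
  have hx : x = ((adelicGroupData (↥(maximalRealSubfield L)) L (IsCMField.complexConj L) N H).toAutomorphicQuotient b₁,
      (adelicGroupData (↥(maximalRealSubfield L)) L (IsCMField.complexConj L) N H).toAutomorphicQuotient b₂) :=
    Prod.ext hx₁.symm hx₂.symm
  rw [hx, toQuotFun₂_eisenstein_mk L e H dV hdV dW hdW ιA hιAr E hE]
  refine (hC _).trans (mul_le_mul_of_nonneg_left ?_ hC0)
  exact (show φ (b₁, b₂) ≤ M₀ from hM₀ ⟨(b₁, b₂), ⟨hb₁, hb₂⟩, rfl⟩).trans (le_max_left _ _)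

end Kernel

/-! ## §3 The twist: `s`-independence and square-integrability -/

section Twist

variable (χ : HeckeCharacter L)

include hdV0 hdW0 in
/-- **The doubling twist does not depend on `s`**: `χ_s(ι(a, a)) = χ(det(a ⊗ 1))` for every `s` (★ `siegelDeltaCharacter_iotaV_diag`: `|det_Δ ι(a,a)| = 1`).
[cite: HarrisKudlaSweet1996, §1 (1.11)–(1.15)] [cite: Liu2021, Lem. B.11 p. 102] -/
theorem twist_eq_twist (s s' : ℂ) (a : UnitaryGroup.adelic (Fp L) L (IsCMField.complexConj L) N (Matrix.diagonal dV)) :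
    siegelDeltaCharacter L e dV hdV dW hdW χ s (iotaV L e dV hdV dW hdW (a, a)) =
      siegelDeltaCharacter L e dV hdV dW hdW χ s' (iotaV L e dV hdV dW hdW (a, a)) := by
  rw [siegelDeltaCharacter_iotaV_diag L e dV hdV hdV0 dW hdW hdW0 χ s, siegelDeltaCharacter_iotaV_diag L e dV hdV hdV0 dW hdW hdW0 χ s']

include hdV0 hdW0 ht hg hιA in
/-- **`T̄ · w′ ∈ L²(μ)`** for `w′ ∈ L²(μ)` on the compact `[G]`, `T̄(x) = conj χ_s(ι(a_x, a_x))` the doubling twist (continuous ★ `continuous_twist`, hence bounded;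
Hölder `∞ · 2 = 2`). [cite: Liu2021, Lem. B.11 p. 102] -/
theorem memLp_two_twist_mul [CompactSpace (adelicGroupData (↥(maximalRealSubfield L)) L (IsCMField.complexConj L) N H).automorphicQuotient]
    (μ : Measure (adelicGroupData (↥(maximalRealSubfield L)) L (IsCMField.complexConj L) N H).automorphicQuotient) [IsFiniteMeasure μ] (s : ℂ)
    {w' : (adelicGroupData (↥(maximalRealSubfield L)) L (IsCMField.complexConj L) N H).automorphicQuotient → ℂ} (hw' : MemLp w' 2 μ) :
    MemLp (fun x => starRingEnd ℂ (siegelDeltaCharacter L e dV hdV dW hdW χ s (iotaV L e dV hdV dW hdW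
        (ιA ((Quotient.out (x : (adelicGroupData (↥(maximalRealSubfield L)) L (IsCMField.complexConj L) N H).Adelic ⧸
              (adelicGroupData (↥(maximalRealSubfield L)) L (IsCMField.complexConj L) N H).quotientSubgroup)) :
              (adelicGroupData (↥(maximalRealSubfield L)) L (IsCMField.complexConj L) N H).Adelic)⁻¹,
         ιA ((Quotient.out (x : (adelicGroupData (↥(maximalRealSubfield L)) L (IsCMField.complexConj L) N H).Adelic ⧸
              (adelicGroupData (↥(maximalRealSubfield L)) L (IsCMField.complexConj L) N H).quotientSubgroup)) :
              (adelicGroupData (↥(maximalRealSubfield L)) L (IsCMField.complexConj L) N H).Adelic)⁻¹))) * w' x) 2 μ := by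
  have hc := continuous_twist L e H dV hdV hdV0 dW hdW hdW0 t ht g hg ιA hιA χ s
  obtain ⟨C, hC⟩ := (isCompact_univ.image hc).isBounded.exists_norm_le
  have htop : MemLp _ ∞ μ := memLp_top_of_bound (μ := μ) hc.aestronglyMeasurable C (Eventually.of_forall fun x => hC _ (mem_image_of_mem _ (mem_univ x)))
  exact MemLp.mul' hw' htop

end Twist

end Summit.HodgeConjecture.HodgeConjecture.Cruxes.HLiu418.K2LiuEisensteinPairingKernel

end
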